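import Summits.MatrixMultiplication.OmegaCensus.SmallFormats.MatMul22nRankGF7ThreeNPlusFourReduction
import Summits.MatrixMultiplication.OmegaCensus.SmallFormats.MatMul22nRankGF7Slack3Counting
import HarnessLib

/-!
# ω-census family (a): the LP floor of the `𝔽₇` X-cap instrument, `R_𝔽₇(⟨2,2,n⟩) ≥ ⌈52n/17⌉` (`n ≥ 35`), in the kernel

Cell `pub-omega` (unit `pub-omega-tensor-g14`), topic `Summits/MatrixMultiplication/OmegaCensus` (sub-folder `SmallFormats`).
Framing (verbatim): lottery ticket; floor = certified bounds/negative ranges. HONEST FRAMING: this is the plain LP bound of the slack-`s`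
X-cap system (`tensor-g9/METHOD-LIMIT.md §2`: LP optimum `s(q²+3) = 52s`), made a kernel theorem by the counting identity
`tight_count7` (`Σ_tangent + 2·Σ_row-plane = 8·Σ_{j<400} x_j`, p330531): every point of `xcapSys7s s` has total `≤ 52s`, i.e.
`NoTightPoint7 s (52s+1)` for EVERY `s`; with the landed ladder step `floor_succ_of_noTightPoint7` and the floor `3n+3` (`n ≥ 33`) this gives
`3n + s + 1 ≤ R_𝔽₇(⟨2,2,n⟩)` whenever `n ≥ 17s + 1` (`s ≥ 2`, `n ≥ 33`), i.e. `R ≥ 3n + ⌈n/17⌉ = ⌈52n/17⌉`. The census CELLS are exactly the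
`n = 17s` left open by this floor (`n = 51`: R291; `n = 68`: `NoTightPoint7 4 208`, p335720; `n = 85`: `NoTightPoint7 5 260`, below).
Nothing here is progress on `ω`.
-/

namespace Summit.MatrixMultiplication.OmegaCensus.SmallFormats

open Finset Literature.Computability.AlgebraicComplexity

/-- **LP floor of the slack-`s` system.** Every box point of the 1274 cap / row-plane rows of `xcapSys7s s` has total `≤ 52·s`:
`NoTightPoint7 s (52s + 1)`. Proof: add the 384 tangent rows and twice the 8 row-plane rows; by `tight_count7` the left side is
`8·Σ_{j<400} x_j + 400·x₄₀₀`, the right side is `384s + 32s = 416s`. -/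
theorem noTightPoint7_lp (s : ℕ) : NoTightPoint7 s (52 * s + 1) := by
  intro x _hbox hrows
  have hT : ∀ r ∈ range 384, xrs7 x r + (x 400 : ℤ) ≤ (s : ℤ) := by
    intro r hr
    have hr' : r < 384 := mem_range.1 hr
    have h := hrows r (by omega)
    unfold capRowVal7 at h
    rw [capRow_eq_xrs7 x (by omega)] at h
    have : rhs7s s r = (s : ℤ) := by unfold rhs7s; rw [if_pos (by omega)]
    rw [this] at h
    exact h
  have hR : ∀ k ∈ range 8, xrs7 x (1266 + k) + (x 400 : ℤ) ≤ 2 * (s : ℤ) := by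
    intro k hk
    have hk' : k < 8 := mem_range.1 hk
    have h := hrows (1266 + k) (by omega)
    unfold capRowVal7 at h
    rw [capRow_eq_xrs7 x (by omega)] at h
    have : rhs7s s (1266 + k) = 2 * (s : ℤ) := by unfold rhs7s; rw [if_neg (by omega), if_pos (by omega)]
    rw [this] at h
    exact h
  have hT' := sum_le_sum hT
  have hR' := sum_le_sum hR
  simp only [sum_add_distrib, sum_const, card_range, nsmul_eq_mul, Nat.cast_ofNat] at hT' hR'
  have htc := tight_count7 x
  have hz : (0 : ℤ) ≤ (x 400 : ℤ) := Int.natCast_nonneg (x 400)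
  have key : ∑ j ∈ range 400, (x j : ℤ) + (x 400 : ℤ) ≤ 52 * (s : ℤ) := by linarith
  rw [sum_range_succ]
  push_cast
  linarith

/-- **The LP ladder.** For `s ≥ 2`, `n ≥ 33` and `n ≥ 17s + 1`: `3n + s + 1 ≤ R_𝔽₇(⟨2,2,n⟩)` (induction on `s` from the floor `3n+3`,
each step by `floor_succ_of_noTightPoint7 (noTightPoint7_lp (s+1))`). -/
theorem lp_ladder_gf7 (s : ℕ) (hs : 2 ≤ s) :
    ∀ n : ℕ, 33 ≤ n → 17 * s + 1 ≤ n → 3 * n + s + 1 ≤ tensorRank (matMulTensor (ZMod 7) 2 2 n) := by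
  induction s, hs using Nat.le_induction with
  | base =>
      intro n h33 _
      have h := three_mul_add_three_le_tensorRank_matMulTensor_22n_gf7_from33 n (by omega)
      omega
  | succ s hs ih =>
      intro n h33 hn
      have hprev : 3 * n + (s + 1) ≤ tensorRank (matMulTensor (ZMod 7) 2 2 n) := by
        have := ih n h33 (by omega); omega
      have h := floor_succ_of_noTightPoint7 (noTightPoint7_lp (s + 1)) n (by omega) hprev
      omega

/-- **LP floor, closed form.** `3n + ⌈n/17⌉ ≤ R_𝔽₇(⟨2,2,n⟩)` for every `n ≥ 35` (`⌈n/17⌉ = (n + 16) / 17`). -/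
theorem lp_floor_gf7 (n : ℕ) (hn : 35 ≤ n) :
    3 * n + (n + 16) / 17 ≤ tensorRank (matMulTensor (ZMod 7) 2 2 n) := by
  have h := lp_ladder_gf7 ((n - 1) / 17) (by omega) n (by omega) (by omega)
  have e : (n - 1) / 17 + 1 = (n + 16) / 17 := by omega
  omega

/-- The slack-4 instance of the ladder: `3n + 5 ≤ R_𝔽₇(⟨2,2,n⟩)` for every `n ≥ 69`, UNCONDITIONALLY (the cell `n = 68` is exactly what
`NoTightPoint7 4 208` adds, `three_mul_add_five_le_of_noTightPoint7`). -/
theorem three_mul_add_five_le_tensorRank_matMulTensor_22n_gf7_from69 (n : ℕ) (hn : 69 ≤ n) :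
    3 * n + 5 ≤ tensorRank (matMulTensor (ZMod 7) 2 2 n) := by
  have h := lp_ladder_gf7 4 (by norm_num) n (by omega) (by omega)
  omega

/-- **Reduction for the next census cell `n = 85`.** `NoTightPoint7 5 260` (`M₇(5) ≤ 259`) implies `3n + 6 ≤ R_𝔽₇(⟨2,2,n⟩)` for every
`n ≥ 85` (for `n ≥ 86` this is already the LP floor; the content is `261 ≤ R_𝔽₇(⟨2,2,85⟩)`). -/
theorem three_mul_add_six_le_of_noTightPoint7 (H : NoTightPoint7 5 260) (n : ℕ) (hn : 85 ≤ n) :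
    3 * n + 6 ≤ tensorRank (matMulTensor (ZMod 7) 2 2 n) :=
  floor_succ_of_noTightPoint7 H n (by omega) (three_mul_add_five_le_tensorRank_matMulTensor_22n_gf7_from69 n (by omega))

/-- The cell itself, conditionally: `NoTightPoint7 5 260 → 261 ≤ R_𝔽₇(⟨2,2,85⟩)`. -/
theorem tensorRank_matMulTensor_2_2_85_gf7_ge_of_noTightPoint7 (H : NoTightPoint7 5 260) :
    261 ≤ tensorRank (matMulTensor (ZMod 7) 2 2 85) :=
  three_mul_add_six_le_of_noTightPoint7 H 85 le_rfl

/-- **Reduction for the cell `n = 102`.** `NoTightPoint7 6 312` (`M₇(6) ≤ 311`) implies `3n + 7 ≤ R_𝔽₇(⟨2,2,n⟩)` for every `n ≥ 102`. -/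
theorem three_mul_add_seven_le_of_noTightPoint7 (H : NoTightPoint7 6 312) (n : ℕ) (hn : 102 ≤ n) :
    3 * n + 7 ≤ tensorRank (matMulTensor (ZMod 7) 2 2 n) := by
  have hprev : 3 * n + 6 ≤ tensorRank (matMulTensor (ZMod 7) 2 2 n) := by
    have h := lp_ladder_gf7 5 (by norm_num) n (by omega) (by omega); omega
  exact floor_succ_of_noTightPoint7 H n (by omega) hprev

end Summit.MatrixMultiplication.OmegaCensus.SmallFormats
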